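import Summits.Ventures.PercRepro.C041RcPortCountSum
import Summits.Ventures.PercRepro.C041SkeletonCountAll

/-!
# THEOREM R on skeletons, the red-connected-attachment family: the sum over all colourings (p6, gen 24)

Setting of `C041RcPortCountSum`.  Every source of the rc family lies in exactly one `rcSrcSet O`, `O` = its bare
part (`bareOf S`, `C041SkeletonCountAll`); summing `sum_goodDegree_nonneg_rc_of_bare` over `O` gives mine-3's
THEOREM R as ONE inequality (`sum_goodDegree_nonneg_rc`): ROW C-041 `(G⅔)` restricted to the sources all of whose
attached zones are internally red-connected — `0 ≤ Σ_{S ∈ 𝒮_rc} (3·[Good_a S] + 3·[Good_b S] − 2)` on every skeleton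
with an edge between the terminals, the probe not adjacent to a terminal, `c ≠ a, b` and `a ≠ b`; the
singleton-attachment family `sum_goodDegree_nonneg_sing` is the sub-family of singleton zones.
-/

namespace PercRepro

namespace MultiGraph

open Finset ZonePort

variable {V E : Type*} {G : MultiGraph V E}

section All

variable [Fintype V] [Fintype E] [DecidableEq E] (a b c : V) (hca : c ≠ a) (hcb : c ≠ b)
  (hc : ∀ e, ¬ G.Joins e c a ∧ ¬ G.Joins e c b) (hne : a ≠ b) (habE : ∃ e, G.Joins e a b)

open Classical in
/-- The sources of the rc family (all bare colourings): the sources all of whose attached zones are rc. -/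
noncomputable def rcSrcAll (G : MultiGraph V E) (a b c : V) : Finset (Config E) :=
  univ.filter fun S : Config E => G.IsRcSrc a b c (G.bareOf a b S) S

omit [Fintype E] [DecidableEq E] in
/-- The source condition with the bare part of a configuration agreeing with it. -/
theorem isRcSrc_congr {S S₀ : Config E} (h : G.bareOf a b S = G.bareOf a b S₀) :
    G.IsRcSrc a b c (G.bareOf a b S) S ↔ G.IsRcSrc a b c (G.bareOf a b S₀) S := by
  rw [h]

open Classical in
/-- **The fibre of the bare part is `rcSrcSet`.** -/
theorem filter_bareOf_eq_rc (S₀ : Config E) :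
    (G.rcSrcAll a b c).filter (fun S => G.bareOf a b S = G.bareOf a b S₀) =
      G.rcSrcSet a b c (G.bareOf a b S₀) := by
  ext S
  unfold rcSrcAll rcSrcSet
  simp only [mem_filter, mem_univ, true_and]
  constructor
  · rintro ⟨hS, hb⟩
    exact (isRcSrc_congr a b c hb).1 hS
  · intro hS
    have hb : G.bareOf a b S = G.bareOf a b S₀ := bareOf_eq_of_agreeBare a b hS.1
    exact ⟨(isRcSrc_congr a b c hb).2 hS, hb⟩

include hca hcb hc hne habE in
open Classical in
/-- **ROW C-041 `(G⅔)` on the red-connected-attachment sources** (mine-3's THEOREM R, summed over the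
colourings): `0 ≤ Σ_{S ∈ rcSrcAll} (3·[Good_a S] + 3·[Good_b S] − 2)`. -/
theorem sum_goodDegree_nonneg_rc :
    0 ≤ ∑ S ∈ G.rcSrcAll a b c,
      ((if G.WalkAvoiding S (G.cluster Sᶜ a) c b then (3 : ℤ) else 0) +
        (if G.WalkAvoiding S (G.cluster Sᶜ b) c a then 3 else 0) - 2) := by
  rw [← Finset.sum_fiberwise (G.rcSrcAll a b c) (G.bareOf a b)]
  apply Finset.sum_nonneg
  intro O _
  by_cases h : ((G.rcSrcAll a b c).filter fun S => G.bareOf a b S = O).Nonempty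
  · obtain ⟨S₀, hS₀⟩ := h
    rw [mem_filter] at hS₀
    rw [← hS₀.2, filter_bareOf_eq_rc a b c S₀]
    exact sum_goodDegree_nonneg_rc_of_bare hca hcb hc hne habE _
  · rw [Finset.not_nonempty_iff_eq_empty.1 h, Finset.sum_empty]

end All

end MultiGraph

end PercRepro
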